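import Summits.ResolutionOfSingularities.ResolutionOfSingularities.Theorems.MarkedTransferCampaignW21TopDegreeLe
import Mathlib.RingTheory.MvPowerSeries.NoZeroDivisors
import HarnessLib

/-!
# [OURS · L1 W2.1] The EXACT ORDER FORMULA for the Case-(I) diff-product: `OrderFormulaCaseIPos p` — PROVED for every
# prime `p` (exponent `e > 0`)

Rung L (rescue) of cell res-hironaka, RESCUE-SEED row L-G2, slot W2.1, seat res-L1-s21-pv-1. Vocabulary: the ERRATUM
companion `MarkedTransferCampaignW21OrderBoundPos.lean` (res-L1-type-o3, p469452): `OrderFormulaCaseIPos p` — under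
`Standing` and `0 < e`, `ord H♭(ε) = min_j q|γ_j| + min {|a+pb+qc| − q|γ₀| : u(a,b,c) ≠ 0, γ₀ ≼_p c digitwise}`, typed
without `min` as «`ord H♭ε + q|γ₀| ≤ q|γ_j| + |a+pb+qc|` for all admissible `(j, t)`, with equality for some admissible
`(j, t)`». This is the general-`(p, e)` form of the closed-form certificate kill test K2.1 (res-L1-k21) registered and
verified at `p = q = 2` («Case I: ord H♭_I ε = 2μ + min(|α|, s₀)», 0 mismatches on > 10⁹ supports, engine-2 repro
res-L1-repro-2).

THIS FILE PROVES `orderFormulaCaseIPos_holds : ∀ p, OrderFormulaCaseIPos p`. Ingredients beyond the lower bounds of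
`MarkedTransferCampaignW21LucasBound.lean` / `…ExactClass.lean`: `K⟦x⟧` is a domain (`MvPowerSeries.order_mul`), and the
two factors have EXACTLY the orders `q·min_j |γ_j|` and `min_adm (|a+pb+qc| − q|γ₀|)`, because their lowest candidate
monomials carry non-zero coefficients: (first factor) the term `u_j x^{α+pβ+qγ_j}` survives `∂^{(α+pβ)}` with binomial
`≡ 1 (mod p)` (two-block Lucas) and, for `γ_j` of minimal length, no other top-block term reaches `x^{qγ_j}`
(`gamma_injective`, coefficients in `ρ^ℓ` only raise degrees); (second factor) the admissible term `t⋆` of minimal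
`|a+pb+qc|` survives `∂^{(qγ₀)}` with binomial `≢ 0 (mod p)` (CONVERSE digit criterion, Lucas' theorem
`Choose.choose_modEq_prod_range_choose_nat`: `γ₀ ≼_p c ⇒ p ∤ C(c, γ₀)`), and no other admissible term reaches its
monomial (injectivity of `(a,b,c) ↦ a+pb+qc` at `e ≥ 1`, `tripleExp_injective`); the surviving coefficients are
`C · u(0)` with `u` a unit. Everything here is OURS / folklore; nothing is a statement of or about the manuscript under
adjudication (GAP row R05); AI-produced formalisation, expert review is stronger than AI review.

## References
* N. J. Fine, *Binomial coefficients modulo a prime*, Amer. Math. Monthly 54 (1947) 589–592, Thms 1–2 [Fine1947].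
* Mathlib `Choose.choose_modEq_prod_range_choose_nat` (Lucas), `MvPowerSeries.order_mul` (orders add in a domain).
-/

noncomputable section

set_option linter.dupNamespace false -- mandated namespace of this single-conjunct summit

namespace Summit.ResolutionOfSingularities.ResolutionOfSingularities.Theorems

namespace CampaignW21

open Literature.AlgebraicGeometry.Hironaka2017.S08UnitMonomial
open Literature.AlgebraicGeometry.Hironaka2017.S09LLUED
open Literature.AlgebraicGeometry.Hironaka2017.S09LLUED.TopFrontier
open Literature.AlgebraicGeometry.Resolution
open Literature.RingTheory.MvPowerSeries
open MvPowerSeries Finsupp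

/-! ## 1. Arithmetic: the converse digit criterion and the two binomial non-vanishings -/

section Arithmetic

variable {p : ℕ} [hp : Fact p.Prime]

omit hp in
/-- Digitwise `≤` implies `≤` (base `p ≥ 2`). [folklore] -/
theorem le_of_digitLE (hp1 : 1 < p) : ∀ {g c : ℕ}, DigitLE p g c → g ≤ c := by
  intro g
  induction g using Nat.strong_induction_on with
  | _ g ih =>
    intro c h
    by_cases hg : g = 0
    · rw [hg]; exact Nat.zero_le _
    · have h0 : g % p ≤ c % p := by simpa using h 0
      have h' : DigitLE p (g / p) (c / p) := fun d => by
        have := h (d + 1)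
        rw [pow_succ', ← Nat.div_div_eq_div_mul, ← Nat.div_div_eq_div_mul] at this
        exact this
      have ih' := ih (g / p) (Nat.div_lt_self (Nat.pos_of_ne_zero hg) hp1) h'
      calc g = p * (g / p) + g % p := (Nat.div_add_mod g p).symm
        _ ≤ p * (c / p) + c % p := add_le_add (Nat.mul_le_mul_left _ ih') h0
        _ = c := Nat.div_add_mod c p

omit hp in
/-- `p ∤ C(c, g)` for `g ≤ c < p` (`p` prime): `C(c,g) · g! · (c−g)! = c!` and `p ∤ c!`. [folklore] -/
theorem not_dvd_choose_of_lt (hpp : p.Prime) {c g : ℕ} (hc : c < p) (hg : g ≤ c) : ¬ p ∣ c.choose g := by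
  intro h
  have h1 : p ∣ Nat.factorial c := by
    rw [← Nat.choose_mul_factorial_mul_factorial hg, mul_assoc]
    exact dvd_mul_of_dvd_left h _
  exact absurd ((Nat.Prime.dvd_factorial hpp).mp h1) (not_le.mpr hc)

/-- **Converse digit criterion** (Lucas / Fine): if every base-`p` digit of `g` is `≤` that of `c` (`DigitLE p g c`) then
`p ∤ C(c, g)`. [cite: Fine1947, Thm 2] -/
theorem not_dvd_choose_of_digitLE {c g : ℕ} (h : DigitLE p g c) : ¬ p ∣ c.choose g := by
  have hpp := hp.out
  have hca : c < p ^ (c + g) := lt_of_lt_of_le (Nat.lt_pow_self hpp.one_lt) (Nat.pow_le_pow_right hpp.pos (by omega))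
  have hga : g < p ^ (c + g) := lt_of_lt_of_le (Nat.lt_pow_self hpp.one_lt) (Nat.pow_le_pow_right hpp.pos (by omega))
  have hmod := Choose.choose_modEq_prod_range_choose_nat hca hga
  intro hdvd
  have hprod : p ∣ ∏ i ∈ Finset.range (c + g), (c / p ^ i % p).choose (g / p ^ i % p) :=
    (hmod.dvd_iff dvd_rfl).mp hdvd
  obtain ⟨i, -, hi⟩ := (Prime.dvd_finsetProd_iff hpp.prime _).mp hprod
  exact not_dvd_choose_of_lt hpp (Nat.mod_lt _ hpp.pos) (h i) hi

variable {n e : ℕ}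

/-- **The top-block terms survive `∂^{(α+pβ)}` with binomial `≢ 0`**: for `α_i + pβ_i < p^e` (digit ranges, `0 < e`),
`p ∤ ∏_s C(α_s + pβ_s + q γ_s, α_s + pβ_s)` (each factor `≡ C(α_s+pβ_s, α_s+pβ_s)·C(γ_s, 0) = 1` by two-block Lucas).
[cite: Fine1947, Thm 1] -/
theorem not_dvd_prod_choose_top (he : 0 < e) {α β γ : Fin n →₀ ℕ} (hα : ∀ i, α i < p)
    (hβ : ∀ i, β i < p ^ (e - 1)) :
    ¬ p ∣ ∏ s, ((α + p • β) s + (p ^ e • γ) s).choose ((α + p • β) s) := by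
  intro h
  obtain ⟨s, -, hs⟩ := (Prime.dvd_finsetProd_iff hp.out.prime _).mp h
  have hX : (α + p • β) s = α s + p * β s := by simp only [Finsupp.add_apply, Finsupp.smul_apply, smul_eq_mul]
  have hγ : (p ^ e • γ) s = p ^ e * γ s := by simp only [Finsupp.smul_apply, smul_eq_mul]
  rw [hX, hγ] at hs
  have hlt := add_mul_lt_pow he (hα s) (hβ s)
  have hmod := choose_twoBlock_modEq (p := p) e (γ s) 0 hlt hlt
  rw [mul_zero, add_zero, Nat.choose_self, Nat.choose_zero_right, mul_one] at hmod
  exact hp.out.one_lt.ne' (Nat.dvd_one.mp ((hmod.dvd_iff dvd_rfl).mp hs))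

/-- **An admissible term survives `∂^{(qγ₀)}` with binomial `≢ 0`**: if `qγ₀ + d = a + pb + qc` (digit ranges,
`0 < e`) and `γ₀ ≼_p c` digitwise, then `p ∤ ∏_s C(qγ₀,s + d_s, qγ₀,s)` (each factor `≡ C(a_s+pb_s, 0)·C(c_s, γ₀,s)`,
and `p ∤ C(c_s, γ₀,s)` by the converse digit criterion). [cite: Fine1947, Thm 2] -/
theorem not_dvd_prod_choose_adm (he : 0 < e) {a b c γ₀ d : Fin n →₀ ℕ} (ha : ∀ i, a i < p)
    (hb : ∀ i, b i < p ^ (e - 1)) (hE : p ^ e • γ₀ + d = a + p • b + p ^ e • c)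
    (hdig : ∀ i, DigitLE p (γ₀ i) (c i)) :
    ¬ p ∣ ∏ s, ((p ^ e • γ₀) s + d s).choose ((p ^ e • γ₀) s) := by
  intro h
  obtain ⟨s, -, hs⟩ := (Prime.dvd_finsetProd_iff hp.out.prime _).mp h
  have hEs : (p ^ e • γ₀) s + d s = (a s + p * b s) + p ^ e * c s := by
    have := DFunLike.congr_fun hE s
    simp only [Finsupp.add_apply, Finsupp.smul_apply, smul_eq_mul] at this ⊢
    omega
  have hY : (p ^ e • γ₀) s = 0 + p ^ e * γ₀ s := by simp only [Finsupp.smul_apply, smul_eq_mul, zero_add]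
  rw [hEs, hY] at hs
  have hmod := choose_twoBlock_modEq (p := p) e (c s) (γ₀ s) (add_mul_lt_pow he (ha s) (hb s))
    (Nat.pow_pos hp.out.pos)
  rw [Nat.choose_zero_right, one_mul] at hmod
  exact not_dvd_choose_of_digitLE (hdig s) ((hmod.dvd_iff dvd_rfl).mp hs)

omit hp in
/-- Exponents: `a ≤ b` with `|b| ≤ |a|` forces `a = b`. [folklore] -/
theorem eq_of_le_of_degree_le {σ : Type*} {a b : σ →₀ ℕ} (h : a ≤ b) (hd : b.degree ≤ a.degree) : a = b := by
  obtain ⟨c, rfl⟩ := exists_add_of_le h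
  rw [map_add] at hd
  have hc : c.degree = 0 := by omega
  rw [(Finsupp.degree_eq_zero_iff c).mp hc, add_zero]

omit hp in
/-- Exponents: `q • a ≤ q • b` with `q > 0` forces `a ≤ b`. [folklore] -/
theorem le_of_smul_le_smul {σ : Type*} {q : ℕ} (hq : 0 < q) {a b : σ →₀ ℕ} (h : q • a ≤ q • b) : a ≤ b :=
  fun i => Nat.le_of_mul_le_mul_left (by simpa only [Finsupp.smul_apply, smul_eq_mul] using h i) hq

end Arithmetic

/-! ## 2. The exact order of the first factor `∂^{(α+pβ)} ε` -/

section Factors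

variable (p : ℕ) [hp : Fact p.Prime] {K : Type} [Field K] [CharP K p] {n e ℓ : ℕ}

/-- **`ord ∂^{(α+pβ)} ε ≤ q|γ_j|` for `γ_j` of minimal length** (standard expression, `0 < e`, all coordinates of
`α + pβ` `< p^ℓ`): the coefficient of `x^{qγ_j}` in `∂^{(α+pβ)}ε` is `C · u_j(0) ≠ 0` — the top-block term `j` survives
with `C ≢ 0 (mod p)`, and no other term reaches `x^{qγ_j}` (Lucas selection leaves only top-block terms
`u_{j'} C' x^{qγ_{j'}}`, whose monomials are `≥ qγ_{j'}`, and `qγ_{j'} ≤ qγ_j` with `|γ_j|` minimal forces `j' = j`).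
[folklore] -/
theorem order_hasseDeriv_top_le (he : 0 < e) {ε : MvPowerSeries (Fin n) K}
    (S : StandardExpression p (xs K n) e ℓ ε)
    (hX : ∀ s, (alpha S.support S.u + p • beta S.support S.u) s < p ^ ℓ)
    (j : Fin (frontierLength S.support S.u))
    (hmin : ∀ j' : Fin (frontierLength S.support S.u), (gamma S.support S.u j).degree ≤ (gamma S.support S.u j').degree) :
    (hasseDeriv (alpha S.support S.u + p • beta S.support S.u) ε).order ≤
      ((p ^ e * (gamma S.support S.u j).degree : ℕ) : ℕ∞) := by
  classical
  have hp0 : 0 < p := hp.out.pos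
  have hq : 0 < p ^ e := Nat.pow_pos hp0
  have hjT : (alpha S.support S.u, beta S.support S.u, gamma S.support S.u j) ∈ S.support := gamma_mem j
  have hju : S.u (alpha S.support S.u, beta S.support S.u, gamma S.support S.u j) ≠ 0 := u_gamma_ne_zero j
  have key := hasseDeriv_sum_terms p (e := e) S.support S.u S.u_mem hX
  rw [← S.sum_eq] at key
  have hdeg : ((p ^ e * (gamma S.support S.u j).degree : ℕ) : ℕ∞) =
      ((p ^ e • gamma S.support S.u j).degree : ℕ∞) := by rw [map_nsmul, smul_eq_mul]
  rw [hdeg]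
  apply MvPowerSeries.order_le
  rw [key, map_sum, Finset.sum_eq_single (alpha S.support S.u, beta S.support S.u, gamma S.support S.u j)]
  · -- the surviving top-block term `j`
    show coeff (p ^ e • gamma S.support S.u j)
        (S.u (alpha S.support S.u, beta S.support S.u, gamma S.support S.u j) *
          hasseDeriv (alpha S.support S.u + p • beta S.support S.u)
            (monomial (alpha S.support S.u + p • beta S.support S.u + p ^ e • gamma S.support S.u j) (1 : K))) ≠ 0
    rw [hasseDeriv_monomial_add', coeff_mul_monomial, if_pos le_rfl, tsub_self, mul_one, coeff_zero_eq_constantCoeff,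
      prod_choose_eq]
    refine mul_ne_zero ?_ ?_
    · exact (isUnit_constantCoeff _ ((S.u_unit_or_zero _ hjT).resolve_right hju)).ne_zero
    · intro h0
      exact not_dvd_prod_choose_top he (fun i => S.a_lt _ hjT i) (fun i => S.b_lt _ hjT i)
        ((CharP.cast_eq_zero_iff K p _).mp h0)
  · -- every other term misses `x^{qγ_j}`
    intro t ht hne
    by_cases hu : S.u t = 0
    · rw [hu, zero_mul, map_zero]
    by_cases hD : hasseDeriv (alpha S.support S.u + p • beta S.support S.u)
        (monomial (t.1 + p • t.2.1 + p ^ e • t.2.2) (1 : K)) = 0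
    · rw [hD, mul_zero, map_zero]
    have hte : t ∈ effSupport S.support S.u := (mem_effSupport S.support S.u).2 ⟨ht, hu⟩
    obtain ⟨hα, hβ⟩ := le_of_hasseDeriv_monomial_ne_zero he (S.a_lt t ht) (fun i => S.a_lt _ hjT i)
      (S.b_lt t ht) (fun i => S.b_lt _ hjT i) (1 : K) hD
    obtain ⟨h1, h2⟩ := fst_eq_and_snd_eq_of_le hte hα hβ
    obtain ⟨j', hj'⟩ := exists_gamma_eq_of_mem_topBlock ((mem_topBlock S.support S.u).2 ⟨hte, h1, h2⟩)
    have hnd : ¬ p ^ e • t.2.2 ≤ p ^ e • gamma S.support S.u j := by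
      intro hle
      apply hne
      have hle' : t.2.2 ≤ gamma S.support S.u j := le_of_smul_le_smul hq hle
      have hdeg_le : (gamma S.support S.u j).degree ≤ t.2.2.degree := hj' ▸ hmin j'
      exact Prod.ext h1 (Prod.ext h2 (eq_of_le_of_degree_le hle' hdeg_le))
    rw [h1, h2, hasseDeriv_monomial_add', coeff_mul_monomial, if_neg hnd]
  · intro h; exact absurd hjT h

/-- **`ord ∂^{(qγ₀)} ε + q|γ₀| ≤ |a⋆ + pb⋆ + qc⋆|` for an admissible effective term `t⋆ = (a⋆,b⋆,c⋆)` of minimal total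
degree** (standard expression, `0 < e`, all coordinates of `qγ₀` `< p^ℓ`; admissible = `γ₀ ≼_p c` digitwise): the
coefficient of `x^{a⋆+pb⋆+qc⋆ − qγ₀}` in `∂^{(qγ₀)}ε` is `C · u⋆(0) ≠ 0` (`C ≢ 0 (mod p)` by the converse digit criterion;
the only other survivors are admissible terms, of total degree `≥ |t⋆|`, and equality of exponents forces `t = t⋆` by
mixed-radix injectivity). [folklore] -/
theorem order_hasseDeriv_qgamma_add_le (he : 0 < e) {ε : MvPowerSeries (Fin n) K}
    (S : StandardExpression p (xs K n) e ℓ ε) (γ₀ : Fin n →₀ ℕ) (hXq : ∀ s, (p ^ e • γ₀) s < p ^ ℓ)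
    {ts : ExpTriple n} (hts : ts ∈ effSupport S.support S.u) (hdig : ∀ i, DigitLE p (γ₀ i) (ts.2.2 i))
    (hmin : ∀ t ∈ effSupport S.support S.u, (∀ i, DigitLE p (γ₀ i) (t.2.2 i)) →
      (ts.1 + p • ts.2.1 + p ^ e • ts.2.2).degree ≤ (t.1 + p • t.2.1 + p ^ e • t.2.2).degree) :
    (hasseDeriv (p ^ e • γ₀) ε).order + ((p ^ e * γ₀.degree : ℕ) : ℕ∞) ≤
      ((ts.1 + p • ts.2.1 + p ^ e • ts.2.2).degree : ℕ∞) := by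
  classical
  have hp0 : 0 < p := hp.out.pos
  have hq : 0 < p ^ e := Nat.pow_pos hp0
  obtain ⟨htsT, htsu⟩ := (mem_effSupport S.support S.u).1 hts
  -- `qγ₀ ≤ E t⋆`
  have hle0 : p ^ e • γ₀ ≤ ts.1 + p • ts.2.1 + p ^ e • ts.2.2 := by
    have h1 : γ₀ ≤ ts.2.2 := fun i => le_of_digitLE hp.out.one_lt (hdig i)
    have h2 : p ^ e • γ₀ ≤ p ^ e • ts.2.2 := fun i => by
      simpa only [Finsupp.smul_apply, smul_eq_mul] using Nat.mul_le_mul_left (p ^ e) (h1 i)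
    exact h2.trans le_add_self
  obtain ⟨d, hd⟩ := exists_add_of_le hle0
  have hdegE : ((ts.1 + p • ts.2.1 + p ^ e • ts.2.2).degree : ℕ∞) =
      (d.degree : ℕ∞) + ((p ^ e * γ₀.degree : ℕ) : ℕ∞) := by
    rw [hd, map_add, map_nsmul, smul_eq_mul, Nat.cast_add, add_comm]
  rw [hdegE]
  refine add_le_add ?_ le_rfl
  have key := hasseDeriv_sum_terms p (e := e) S.support S.u S.u_mem hXq
  rw [← S.sum_eq] at key
  apply MvPowerSeries.order_le
  rw [key, map_sum, Finset.sum_eq_single ts]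
  · -- the surviving admissible term `t⋆`
    rw [hd, hasseDeriv_monomial_add', coeff_mul_monomial, if_pos le_rfl, tsub_self, mul_one, coeff_zero_eq_constantCoeff,
      prod_choose_eq]
    refine mul_ne_zero ?_ ?_
    · exact (isUnit_constantCoeff _ ((S.u_unit_or_zero _ htsT).resolve_right htsu)).ne_zero
    · intro h0
      exact not_dvd_prod_choose_adm he (S.a_lt _ htsT) (S.b_lt _ htsT) hd.symm hdig
        ((CharP.cast_eq_zero_iff K p _).mp h0)
  · -- every other term misses `x^d`
    intro t ht hne
    by_cases hu : S.u t = 0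
    · rw [hu, zero_mul, map_zero]
    by_cases hD : hasseDeriv (p ^ e • γ₀) (monomial (t.1 + p • t.2.1 + p ^ e • t.2.2) (1 : K)) = 0
    · rw [hD, mul_zero, map_zero]
    have hte : t ∈ effSupport S.support S.u := (mem_effSupport S.support S.u).2 ⟨ht, hu⟩
    have hdig_t := digitLE_of_hasseDeriv_monomial_ne_zero p he (S.a_lt t ht) (S.b_lt t ht) (1 : K) hD
    by_cases hle : p ^ e • γ₀ ≤ t.1 + p • t.2.1 + p ^ e • t.2.2
    · obtain ⟨d', hd'⟩ := exists_add_of_le hle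
      have hnd : ¬ d' ≤ d := by
        intro hdd
        apply hne
        have h1 : d'.degree ≤ d.degree := Finsupp.degree_mono hdd
        have h2 := hmin t hte hdig_t
        rw [hd', hd, map_add, map_add] at h2
        have hdd' : d' = d := eq_of_le_of_degree_le hdd (by omega)
        have hE : t.1 + p • t.2.1 + p ^ e • t.2.2 = ts.1 + p • ts.2.1 + p ^ e • ts.2.2 := by rw [hd', hd, hdd']
        obtain ⟨e1, e2, e3⟩ := tripleExp_injective hp0 he (S.a_lt t ht) (S.a_lt ts htsT) (S.b_lt t ht)
          (S.b_lt ts htsT) hE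
        exact Prod.ext e1 (Prod.ext e2 e3)
      rw [hd', hasseDeriv_monomial_add', coeff_mul_monomial, if_neg hnd]
    · exact absurd (hasseDeriv_monomial_of_not_le' hle (1 : K)) hD
  · intro h; exact absurd htsT h

end Factors

/-! ## 3. The formula -/

/-- **[OURS · L1 W2.1] `OrderFormulaCaseIPos p` HOLDS for every prime `p`**: under `Standing` and `0 < e`, for standard-
expression data in `K⟦x₁…xₙ⟧` (`char K = p`, `q = p^e`),
`ord H♭(ε) = q·min_j |γ_j| + min {|a+pb+qc| − q|γ₀| : u(a,b,c) ≠ 0, γ₀ ≼_p c}` — the general-`(p,e)` form of kill test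
K2.1's Case-(I) certificate «ord H♭_I ε = 2μ + min(|α|, s₀)». Replaces the role of the printed NAME `d(A,I,0)` (Rem. 9.9
(1) p.51 L5) by a formula; NOT a statement of the manuscript. [folklore] -/
theorem orderFormulaCaseIPos_holds (p : ℕ) [Fact p.Prime] : OrderFormulaCaseIPos p := by
  intro K _ _ n e ℓ he ε S h0 hS
  dsimp only
  classical
  have hp0 : 0 < p := (Fact.out : p.Prime).pos
  -- depth
  have hX : ∀ s, (alpha S.support S.u + p • beta S.support S.u) s < p ^ ℓ := fun s =>
    lt_of_le_of_lt ((Finsupp.le_degree s _).trans (Finsupp.degree_mono le_self_add)) hS.depth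
  have hXq : ∀ s, (p ^ e • gamma S.support S.u ⟨0, h0⟩) s < p ^ ℓ := fun s =>
    lt_of_le_of_lt ((Finsupp.le_degree s _).trans (Finsupp.degree_mono le_add_self)) hS.depth
  -- the minimising index `j⋆`
  obtain ⟨js, -, hjs⟩ := Finset.exists_min_image Finset.univ
    (fun j : Fin (frontierLength S.support S.u) => (gamma S.support S.u j).degree) ⟨⟨0, h0⟩, Finset.mem_univ _⟩
  -- the minimising admissible term `t⋆`
  set Adm := (effSupport S.support S.u).filter
    (fun t => ∀ i : Fin n, DigitLE p (gamma S.support S.u ⟨0, h0⟩ i) (t.2.2 i)) with hAdm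
  have ht0 : (alpha S.support S.u, beta S.support S.u, gamma S.support S.u ⟨0, h0⟩) ∈ Adm :=
    Finset.mem_filter.2 ⟨gamma_mem_effSupport ⟨0, h0⟩, fun i d => le_rfl⟩
  obtain ⟨ts, htsA, hts⟩ := Finset.exists_min_image Adm
    (fun t : ExpTriple n => (t.1 + p • t.2.1 + p ^ e • t.2.2).degree) ⟨_, ht0⟩
  obtain ⟨hts_eff, hdig_ts⟩ := Finset.mem_filter.1 htsA
  have hmin' : ∀ t ∈ effSupport S.support S.u, (∀ i, DigitLE p (gamma S.support S.u ⟨0, h0⟩ i) (t.2.2 i)) →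
      (ts.1 + p • ts.2.1 + p ^ e • ts.2.2).degree ≤ (t.1 + p • t.2.1 + p ^ e • t.2.2).degree :=
    fun t ht hd => hts t (Finset.mem_filter.2 ⟨ht, hd⟩)
  -- the first factor: `ord A = q|γ_{j⋆}|`
  obtain ⟨j1, hj1⟩ := exists_gamma_le_order_hasseDeriv p he S h0 hX
  have hA : (hasseDeriv (alpha S.support S.u + p • beta S.support S.u) ε).order =
      ((p ^ e * (gamma S.support S.u js).degree : ℕ) : ℕ∞) :=
    le_antisymm (order_hasseDeriv_top_le p he S hX js fun j' => hjs j' (Finset.mem_univ _))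
      (le_trans (by exact_mod_cast Nat.mul_le_mul_left _ (hjs j1 (Finset.mem_univ _))) hj1)
  -- the second factor: `ord B + q|γ₀| = |E t⋆|`
  have hB_le := order_hasseDeriv_qgamma_add_le p he S (gamma S.support S.u ⟨0, h0⟩) hXq hts_eff hdig_ts hmin'
  have hq0 : p ^ e * (gamma S.support S.u ⟨0, h0⟩).degree ≤ (ts.1 + p • ts.2.1 + p ^ e • ts.2.2).degree := by
    have h := le_trans le_add_self hB_le
    exact_mod_cast h
  have hB_ge : (((ts.1 + p • ts.2.1 + p ^ e • ts.2.2).degree - p ^ e * (gamma S.support S.u ⟨0, h0⟩).degree : ℕ) :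
      ℕ∞) ≤ (hasseDeriv (p ^ e • gamma S.support S.u ⟨0, h0⟩) ε).order := by
    refine le_order_hasseDeriv_qgamma p he S (gamma S.support S.u ⟨0, h0⟩) hXq _ fun t ht hd _ => ?_
    have := hmin' t ht hd
    omega
  have hB : (hasseDeriv (p ^ e • gamma S.support S.u ⟨0, h0⟩) ε).order =
      (((ts.1 + p • ts.2.1 + p ^ e • ts.2.2).degree - p ^ e * (gamma S.support S.u ⟨0, h0⟩).degree : ℕ) : ℕ∞) := by
    refine le_antisymm ?_ hB_ge
    induction hBo : (hasseDeriv (p ^ e • gamma S.support S.u ⟨0, h0⟩) ε).order using ENat.recTopCoe with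
    | top =>
      rw [hBo, top_add] at hB_le
      exact absurd hB_le (not_le_of_gt (ENat.coe_lt_top _))
    | coe m =>
      rw [hBo, ← Nat.cast_add, Nat.cast_le] at hB_le
      exact_mod_cast (by omega : m ≤ _)
  -- `ord H = ord A + ord B` (`K⟦x⟧` is a domain, `u₀⁻¹` a unit)
  have hunit : ((↑(hS.unit_u0.unit⁻¹) : MvPowerSeries (Fin n) K)).order = 0 := by
    rw [← adicOrder_eq_order]; exact adicOrder_of_isUnit (Units.isUnit _)
  have hH : adicOrder (HFlat.caseI (hasseD K n) hS.unit_u0.unit p (p ^ e)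
      (alpha S.support S.u) (beta S.support S.u) (gamma S.support S.u ⟨0, h0⟩) ε) =
      ((p ^ e * (gamma S.support S.u js).degree +
        ((ts.1 + p • ts.2.1 + p ^ e • ts.2.2).degree - p ^ e * (gamma S.support S.u ⟨0, h0⟩).degree) : ℕ) : ℕ∞) := by
    show adicOrder ((↑(hS.unit_u0.unit⁻¹) : MvPowerSeries (Fin n) K) *
        hasseD K n (alpha S.support S.u + p • beta S.support S.u) ε *
        hasseD K n (p ^ e • gamma S.support S.u ⟨0, h0⟩) ε) = _
    rw [adicOrder_eq_order, MvPowerSeries.order_mul, MvPowerSeries.order_mul, hunit, zero_add, Nat.cast_add]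
    exact congrArg₂ (· + ·) hA hB
  refine ⟨fun j t ht hdig => ?_, ⟨js, ts, hts_eff, hdig_ts, ?_⟩⟩
  · rw [hH, ← Nat.cast_add, Nat.cast_le]
    have h1 := Nat.mul_le_mul_left (p ^ e) (hjs j (Finset.mem_univ _))
    have h2 := hmin' t ht hdig
    omega
  · rw [hH, ← Nat.cast_add, Nat.cast_le]
    omega

end CampaignW21

end Summit.ResolutionOfSingularities.ResolutionOfSingularities.Theorems

end
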